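import Summits.QuantumFields.QCD.Theses.EulerDescent

/-!
# Crux `EulerDescent.HonestHeavyAnchor` (stmt-QuantumFields-16901), line `bounded_locator` rev 3, stub
# `stub_branchTransition` (T): the NON-MASSIVENESS CERTIFICATES (long-range order / power law ⇒ not massive)

Worker file for the registered stub `stub_branchTransition` of `Cruxes/HonestHeavyAnchor/Lines/bounded_locator.lean`
(rev 3, the ray split): for `N_f ∈ {2,3}` there is `β₀` such that at EVERY inverse coupling `β ≥ β₀` SOME degenerate bare
Wilson mass `μ > −1/2` is NON-massive for honest lattice QCD (the `(−1)^F`-twisted odd-torus functional `qcdTorusExpect`):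
some pair of gauge-invariant local observables fails to cluster exponentially in Euclidean time at any lattice rate
uniformly in the torus side.  Physically this is the chiral transition of the Wilson axis at fixed weak coupling (Aoki
1984; Sharpe–Singleton 1998: either an Aoki phase with flavour–parity order and massless charged pions, all pions
massless on its edges, or a first-order line with two coexisting vacua).  The stub is open-problem grade and is NOT
proved here: no rigorous result establishes any transition on the Wilson-fermion mass axis at any coupling (the only
rigorous cousin is Salmhofer–Seiler, CMP 139 (1991): chiral long-range order at `β = 0` for STAGGERED fermions, gauge
group `U(N)`, `N ≤ 4`, `d ≥ 4`).

What this file certifies, sorry-free and definition-free, is the last step every future proof of T (and of the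
neighbouring stub R) must end with — turning an infrared witness into the negation of the inlined massive predicate
`∀ R R' A B, ∃ C δ S₀, 0 < δ ∧ ∀ S ≥ S₀, ∀ n ≤ S, ‖⟨A · τ_{n e₀} B⟩ᶜ_{β, 2S+1, μ}‖ ≤ C e^{−δ n}`:

* `nonMassive_of_frequently_lower_bound` (the engine): if for ONE pair `A, B`, along torus sides `2S+1` for `S` in a
  set unbounded above, at separations `n_S ≤ S`, the connected correlation is bounded below by a barrier `b_S` that
  beats every `C e^{−δ n_S}` eventually, then `μ` is not massive (three filters meet: a contradiction
  `b_S ≤ ‖corr‖ ≤ C e^{−δ n_S} < b_S`);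
* `nonMassive_of_longRangeOrder` (L-T1): LONG-RANGE ORDER of one local observable at antipodal Euclidean time on the
  odd torus — `q ≤ ‖⟨A · τ_{S e₀} A⟩ᶜ_{β, 2S+1, μ}‖` for all `S ≥ S₁` with `q > 0` — makes `μ` non-massive
  (`C e^{−δ S} → 0 < q`); `nonMassive_of_longRangeOrder_pair` is the two-observable, any-divergent-separation,
  frequently-in-`S` form (first-order coexistence on the periodic torus, or an order parameter);
* `nonMassive_of_powerLaw_lower_bound` (L-T2): a POWER-LAW lower bound `c/(n+1)^p ≤ ‖corr_S(n)‖` for all `S ≥ S₁`,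
  `n ≤ S` (`c > 0`, real `p`; massless Goldstone pions) makes `μ` non-massive (`C e^{−δ S}(S+1)^p → 0 < c`);
  `nonMassive_of_powerLaw_lower_bound_antipodal` needs it only at `n = S`;
* `branchTransition_of_longRangeOrderFamily` (L-T3, registered sub-goal): a family of such long-range orders — for
  `N_f ∈ {2,3}`, some `β₀`, and for every `β ≥ β₀` some `μ > −1/2` with an observable `A` ordered at antipodal time —
  implies the registered statement T VERBATIM; `branchTransition_of_powerLawFamily` likewise from power laws;
* `branchTransition_of_closingTransition`: T is the `ε = 1/2` instance of the rev-2 stub N (`stub_closingTransition`: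
  for every `ε > 0`, eventually in `β`, a non-massive `μ > −ε`), recorded for the bookkeeping between revisions.

Pure real analysis over `QCDOS.lean` (`Real.tendsto_exp_neg_atTop_nhds_zero`,
`tendsto_rpow_mul_exp_neg_mul_atTop_nhds_zero`, filter bookkeeping); standard axioms; no `def` (the massive predicate
is written out verbatim as in the route file so that registered sub-goals are matched by name + signature).
-/

namespace Summit.QuantumFields.QCD.Theorems.HonestHeavyAnchorBranchTransition

open Filter Topology
open Literature.MathematicalPhysics.QuantumFieldTheory

/-! ## §1 Two decay facts: an exponential bound loses against a constant and against a power law -/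

/-- `C e^{−δ x_S} → 0` along any real sequence `x_S → +∞` (`δ > 0`), hence it is eventually below any `q > 0`.
[folklore] -/
theorem eventually_const_mul_exp_neg_lt :
    ∀ (C δ q : ℝ) (x : ℕ → ℝ), 0 < δ → 0 < q → Tendsto x atTop atTop →
      ∀ᶠ S in atTop, C * Real.exp (-(δ * x S)) < q := by
  intro C δ q x hδ hq hx
  have h1 : Tendsto (fun S => δ * x S) atTop atTop := hx.const_mul_atTop hδ
  have h2 : Tendsto (fun S => Real.exp (-(δ * x S))) atTop (𝓝 0) :=
    Real.tendsto_exp_neg_atTop_nhds_zero.comp h1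
  have h3 : Tendsto (fun S => C * Real.exp (-(δ * x S))) atTop (𝓝 0) := by
    simpa using h2.const_mul C
  exact h3.eventually_lt_const hq

/-- `C e^{−δ S} < c/(S+1)^p` eventually in `S : ℕ` (`δ, c > 0`, any real exponent `p`): `(S+1)^p e^{−δ S} → 0`
(`tendsto_rpow_mul_exp_neg_mul_atTop_nhds_zero` at `S + 1`, times `C e^{δ}`). [folklore] -/
theorem eventually_const_mul_exp_neg_lt_div_rpow :
    ∀ (C δ c p : ℝ), 0 < δ → 0 < c →
      ∀ᶠ S : ℕ in atTop, C * Real.exp (-(δ * S)) < c / ((S : ℝ) + 1) ^ p := by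
  intro C δ c p hδ hc
  have hpos : ∀ S : ℕ, 0 < ((S : ℝ) + 1) ^ p := fun S => Real.rpow_pos_of_pos (by positivity) p
  have h1 : Tendsto (fun y : ℝ => y ^ p * Real.exp (-δ * y)) atTop (𝓝 0) :=
    tendsto_rpow_mul_exp_neg_mul_atTop_nhds_zero p δ hδ
  have h2 : Tendsto (fun S : ℕ => (S : ℝ) + 1) atTop atTop :=
    tendsto_atTop_add_const_right _ 1 tendsto_natCast_atTop_atTop
  have h3 : Tendsto (fun S : ℕ => ((S : ℝ) + 1) ^ p * Real.exp (-δ * ((S : ℝ) + 1))) atTop (𝓝 0) :=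
    h1.comp h2
  have h4 : Tendsto (fun S : ℕ => C * Real.exp δ * (((S : ℝ) + 1) ^ p * Real.exp (-δ * ((S : ℝ) + 1))))
      atTop (𝓝 0) := by
    simpa using h3.const_mul (C * Real.exp δ)
  filter_upwards [h4.eventually_lt_const hc] with S hS
  rw [lt_div_iff₀ (hpos S)]
  have key : C * Real.exp (-(δ * S)) * ((S : ℝ) + 1) ^ p
      = C * Real.exp δ * (((S : ℝ) + 1) ^ p * Real.exp (-δ * ((S : ℝ) + 1))) := by
    have hexp : Real.exp (-(δ * S)) = Real.exp δ * Real.exp (-δ * ((S : ℝ) + 1)) := by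
      rw [← Real.exp_add]
      congr 1
      ring
    rw [hexp]
    ring
  rw [key]
  exact hS

/-! ## §2 The engine: a lower barrier beating every exponential, frequently in the volume, denies massiveness -/

/-- **Non-massiveness from a frequent lower bound (the engine).**  Fix `N_f`, `β`, a degenerate bare mass `μ`, ONE
pair of gauge-invariant local lattice QCD observables `A, B`, separations `n_S` and barriers `b_S`.  If every
exponential bound loses against the barrier eventually (`∀ C, ∀ δ > 0, ∀ᶠ S, C e^{−δ n_S} < b_S`) and, for `S` in a
set unbounded above, `n_S ≤ S` and `b_S ≤ ‖⟨A · τ_{n_S e₀} B⟩ᶜ_{β, 2S+1, μ}‖`, then `μ` is NOT massive at `β`: the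
massive clause for the pair `(A, B)` gives `C, δ, S₀`, and at a common large `S` one would have
`b_S ≤ ‖corr‖ ≤ C e^{−δ n_S} < b_S`. [folklore] -/
theorem nonMassive_of_frequently_lower_bound :
    ∀ (Nf : ℕ) (β μ : ℝ) (R R' : ℕ) (A : QCDLatticeObservable Nf R) (B : QCDLatticeObservable Nf R')
      (n : ℕ → ℕ) (b : ℕ → ℝ),
      (∀ C δ : ℝ, 0 < δ → ∀ᶠ S : ℕ in atTop, C * Real.exp (-(δ * n S)) < b S) →
      (∃ᶠ S : ℕ in atTop, n S ≤ S ∧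
        b S ≤ ‖qcdLatticeConnectedCorr β (2 * S + 1) (fun _ : Fin Nf => μ) A B (n S)‖) →
      ¬ (∀ (R R' : ℕ) (A : QCDLatticeObservable Nf R) (B : QCDLatticeObservable Nf R'),
        ∃ (C δ : ℝ) (S₀ : ℕ), 0 < δ ∧ ∀ S : ℕ, S₀ ≤ S → ∀ n : ℕ, n ≤ S →
          ‖qcdLatticeConnectedCorr β (2 * S + 1) (fun _ : Fin Nf => μ) A B n‖ ≤ C * Real.exp (-(δ * n))) := by
  intro Nf β μ R R' A B n b hsmall hfreq hM
  obtain ⟨C, δ, S₀, hδ, hdecay⟩ := hM R R' A B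
  obtain ⟨S, ⟨hnS, hbS⟩, hlt, hS₀⟩ :=
    (hfreq.and_eventually ((hsmall C δ hδ).and (eventually_ge_atTop S₀))).exists
  exact lt_irrefl _ ((hbS.trans (hdecay S hS₀ (n S) hnS)).trans_lt hlt)

/-! ## §3 (L-T1) Long-range order ⇒ not massive -/

/-- **(L-T1) Long-range order of ONE local observable at antipodal Euclidean time denies massiveness.**  If for some
quark box `R₀`, some gauge-invariant local observable `A`, some `q > 0` and `S₁`, for all `S ≥ S₁` the connected
correlation of `A` with its own translate by `S` lattice units of Euclidean time on the torus of side `2S+1` (the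
antipodal separation) has norm at least `q`, then the degenerate bare mass `μ` is NOT massive at `β` (take `B := A`,
`n := S` in the massive clause: `C e^{−δ S} → 0 < q`).  The certificate of a first-order coexistence seen by the
periodic (twisted) torus functional, or of an order parameter. [folklore] -/
theorem nonMassive_of_longRangeOrder :
    ∀ (Nf : ℕ) (β μ : ℝ) (R₀ : ℕ) (A : QCDLatticeObservable Nf R₀) (q : ℝ) (S₁ : ℕ), 0 < q →
      (∀ S : ℕ, S₁ ≤ S → q ≤ ‖qcdLatticeConnectedCorr β (2 * S + 1) (fun _ : Fin Nf => μ) A A S‖) →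
      ¬ (∀ (R R' : ℕ) (A : QCDLatticeObservable Nf R) (B : QCDLatticeObservable Nf R'),
        ∃ (C δ : ℝ) (S₀ : ℕ), 0 < δ ∧ ∀ S : ℕ, S₀ ≤ S → ∀ n : ℕ, n ≤ S →
          ‖qcdLatticeConnectedCorr β (2 * S + 1) (fun _ : Fin Nf => μ) A B n‖ ≤ C * Real.exp (-(δ * n))) := by
  intro Nf β μ R₀ A q S₁ hq hLRO
  refine nonMassive_of_frequently_lower_bound Nf β μ R₀ R₀ A A (fun S => S) (fun _ => q) ?_ ?_
  · intro C δ hδ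
    exact eventually_const_mul_exp_neg_lt C δ q (fun S : ℕ => (S : ℝ)) hδ hq tendsto_natCast_atTop_atTop
  · exact ((eventually_ge_atTop S₁).mono fun S hS => ⟨le_rfl, hLRO S hS⟩).frequently

/-- **(L-T1, pair form) Long-range order of a PAIR at divergent separations, frequently in the volume, denies
massiveness.**  If for some `A, B`, some `q > 0` and separations `n_S → ∞`, the bound
`q ≤ ‖⟨A · τ_{n_S e₀} B⟩ᶜ_{β, 2S+1, μ}‖` with `n_S ≤ S` holds for `S` in a set unbounded above, then `μ` is not
massive at `β`. [folklore] -/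
theorem nonMassive_of_longRangeOrder_pair :
    ∀ (Nf : ℕ) (β μ : ℝ) (R R' : ℕ) (A : QCDLatticeObservable Nf R) (B : QCDLatticeObservable Nf R')
      (q : ℝ) (n : ℕ → ℕ), 0 < q → Tendsto n atTop atTop →
      (∃ᶠ S : ℕ in atTop, n S ≤ S ∧
        q ≤ ‖qcdLatticeConnectedCorr β (2 * S + 1) (fun _ : Fin Nf => μ) A B (n S)‖) →
      ¬ (∀ (R R' : ℕ) (A : QCDLatticeObservable Nf R) (B : QCDLatticeObservable Nf R'),
        ∃ (C δ : ℝ) (S₀ : ℕ), 0 < δ ∧ ∀ S : ℕ, S₀ ≤ S → ∀ n : ℕ, n ≤ S →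
          ‖qcdLatticeConnectedCorr β (2 * S + 1) (fun _ : Fin Nf => μ) A B n‖ ≤ C * Real.exp (-(δ * n))) := by
  intro Nf β μ R R' A B q n hq hn hfreq
  refine nonMassive_of_frequently_lower_bound Nf β μ R R' A B n (fun _ => q) ?_ hfreq
  intro C δ hδ
  exact eventually_const_mul_exp_neg_lt C δ q (fun S : ℕ => (n S : ℝ)) hδ hq
    (tendsto_natCast_atTop_atTop.comp hn)

/-! ## §4 (L-T2) Power-law lower bound ⇒ not massive -/

/-- **(L-T2, antipodal form) A power-law lower bound at antipodal Euclidean time denies massiveness.**  If for some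
`A, B`, `c > 0`, a real exponent `p` and `S₁`, for all `S ≥ S₁`,
`c/(S+1)^p ≤ ‖⟨A · τ_{S e₀} B⟩ᶜ_{β, 2S+1, μ}‖`, then `μ` is not massive at `β`
(`C e^{−δ S} < c/(S+1)^p` eventually). [folklore] -/
theorem nonMassive_of_powerLaw_lower_bound_antipodal :
    ∀ (Nf : ℕ) (β μ : ℝ) (R R' : ℕ) (A : QCDLatticeObservable Nf R) (B : QCDLatticeObservable Nf R')
      (c p : ℝ) (S₁ : ℕ), 0 < c →
      (∀ S : ℕ, S₁ ≤ S →
        c / ((S : ℝ) + 1) ^ p ≤ ‖qcdLatticeConnectedCorr β (2 * S + 1) (fun _ : Fin Nf => μ) A B S‖) →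
      ¬ (∀ (R R' : ℕ) (A : QCDLatticeObservable Nf R) (B : QCDLatticeObservable Nf R'),
        ∃ (C δ : ℝ) (S₀ : ℕ), 0 < δ ∧ ∀ S : ℕ, S₀ ≤ S → ∀ n : ℕ, n ≤ S →
          ‖qcdLatticeConnectedCorr β (2 * S + 1) (fun _ : Fin Nf => μ) A B n‖ ≤ C * Real.exp (-(δ * n))) := by
  intro Nf β μ R R' A B c p S₁ hc hpow
  refine nonMassive_of_frequently_lower_bound Nf β μ R R' A B (fun S => S)
    (fun S => c / ((S : ℝ) + 1) ^ p) ?_ ?_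
  · intro C δ hδ
    exact eventually_const_mul_exp_neg_lt_div_rpow C δ c p hδ hc
  · exact ((eventually_ge_atTop S₁).mono fun S hS => ⟨le_rfl, hpow S hS⟩).frequently

/-- **(L-T2) A power-law lower bound on the connected correlation denies massiveness.**  If for some `A, B`, `c > 0`,
a real exponent `p` and `S₁`, for all `S ≥ S₁` and all Euclidean-time separations `n ≤ S` on the torus of side
`2S+1`, `c/(n+1)^p ≤ ‖⟨A · τ_{n e₀} B⟩ᶜ_{β, 2S+1, μ}‖` (the decay law of a massless Goldstone channel), then `μ` is
not massive at `β` (specialise to `n = S`). [folklore] -/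
theorem nonMassive_of_powerLaw_lower_bound :
    ∀ (Nf : ℕ) (β μ : ℝ) (R R' : ℕ) (A : QCDLatticeObservable Nf R) (B : QCDLatticeObservable Nf R')
      (c p : ℝ) (S₁ : ℕ), 0 < c →
      (∀ S : ℕ, S₁ ≤ S → ∀ n : ℕ, n ≤ S →
        c / ((n : ℝ) + 1) ^ p ≤ ‖qcdLatticeConnectedCorr β (2 * S + 1) (fun _ : Fin Nf => μ) A B n‖) →
      ¬ (∀ (R R' : ℕ) (A : QCDLatticeObservable Nf R) (B : QCDLatticeObservable Nf R'),
        ∃ (C δ : ℝ) (S₀ : ℕ), 0 < δ ∧ ∀ S : ℕ, S₀ ≤ S → ∀ n : ℕ, n ≤ S →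
          ‖qcdLatticeConnectedCorr β (2 * S + 1) (fun _ : Fin Nf => μ) A B n‖ ≤ C * Real.exp (-(δ * n))) := by
  intro Nf β μ R R' A B c p S₁ hc hpow
  exact nonMassive_of_powerLaw_lower_bound_antipodal Nf β μ R R' A B c p S₁ hc fun S hS => hpow S hS S le_rfl

/-! ## §5 (L-T3) The branch transition T from a family of infrared witnesses on the physical branch -/

/-- **(L-T3) T from a LONG-RANGE-ORDER FAMILY.**  If for `N_f ∈ {2,3}` there is `β₀` such that for every `β ≥ β₀`
some degenerate bare Wilson mass `μ > −1/2` carries a gauge-invariant local observable with long-range order at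
antipodal Euclidean time on all large odd tori (`q ≤ ‖⟨A · τ_{S e₀} A⟩ᶜ_{β, 2S+1, μ}‖`, `S ≥ S₁`, `q > 0`), then
the registered stub `stub_branchTransition` (T) holds VERBATIM.  The hypothesis is the open physics (a transition
of the Wilson axis at fixed weak coupling, in its order-parameter / coexistence form); this implication is its
last, elementary step. [folklore] -/
theorem branchTransition_of_longRangeOrderFamily :
    (∀ Nf : ℕ, Nf = 2 ∨ Nf = 3 → ∃ β₀ : ℝ, ∀ β : ℝ, β₀ ≤ β → ∃ μ : ℝ, -(1 / 2 : ℝ) < μ ∧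
      ∃ (R₀ : ℕ) (A : QCDLatticeObservable Nf R₀) (q : ℝ) (S₁ : ℕ), 0 < q ∧
        ∀ S : ℕ, S₁ ≤ S → q ≤ ‖qcdLatticeConnectedCorr β (2 * S + 1) (fun _ : Fin Nf => μ) A A S‖) →
    ∀ Nf : ℕ, Nf = 2 ∨ Nf = 3 → ∃ β₀ : ℝ, ∀ β : ℝ, β₀ ≤ β → ∃ μ : ℝ, -(1 / 2 : ℝ) < μ ∧
    ¬ (∀ (R R' : ℕ) (A : QCDLatticeObservable Nf R) (B : QCDLatticeObservable Nf R'),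
    ∃ (C δ : ℝ) (S₀ : ℕ), 0 < δ ∧ ∀ S : ℕ, S₀ ≤ S → ∀ n : ℕ, n ≤ S →
    ‖qcdLatticeConnectedCorr β (2 * S + 1) (fun _ : Fin Nf => μ) A B n‖ ≤ C * Real.exp (-(δ * n))) := by
  intro h Nf hNf
  obtain ⟨β₀, hβ⟩ := h Nf hNf
  refine ⟨β₀, fun β hb => ?_⟩
  obtain ⟨μ, hμ, R₀, A, q, S₁, hq, hLRO⟩ := hβ β hb
  exact ⟨μ, hμ, nonMassive_of_longRangeOrder Nf β μ R₀ A q S₁ hq hLRO⟩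

/-- **(L-T3, power-law form) T from a POWER-LAW FAMILY** (massless pions inside the Aoki phase or on its edges): for
`N_f ∈ {2,3}`, some `β₀`, and for every `β ≥ β₀` some `μ > −1/2` with a pair `A, B` whose connected correlation is
bounded below by `c/(n+1)^p` for all `S ≥ S₁`, `n ≤ S` (`c > 0`) — implies T verbatim. [folklore] -/
theorem branchTransition_of_powerLawFamily :
    (∀ Nf : ℕ, Nf = 2 ∨ Nf = 3 → ∃ β₀ : ℝ, ∀ β : ℝ, β₀ ≤ β → ∃ μ : ℝ, -(1 / 2 : ℝ) < μ ∧
      ∃ (R R' : ℕ) (A : QCDLatticeObservable Nf R) (B : QCDLatticeObservable Nf R') (c p : ℝ) (S₁ : ℕ), 0 < c ∧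
        ∀ S : ℕ, S₁ ≤ S → ∀ n : ℕ, n ≤ S →
          c / ((n : ℝ) + 1) ^ p ≤ ‖qcdLatticeConnectedCorr β (2 * S + 1) (fun _ : Fin Nf => μ) A B n‖) →
    ∀ Nf : ℕ, Nf = 2 ∨ Nf = 3 → ∃ β₀ : ℝ, ∀ β : ℝ, β₀ ≤ β → ∃ μ : ℝ, -(1 / 2 : ℝ) < μ ∧
    ¬ (∀ (R R' : ℕ) (A : QCDLatticeObservable Nf R) (B : QCDLatticeObservable Nf R'),
    ∃ (C δ : ℝ) (S₀ : ℕ), 0 < δ ∧ ∀ S : ℕ, S₀ ≤ S → ∀ n : ℕ, n ≤ S →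
    ‖qcdLatticeConnectedCorr β (2 * S + 1) (fun _ : Fin Nf => μ) A B n‖ ≤ C * Real.exp (-(δ * n))) := by
  intro h Nf hNf
  obtain ⟨β₀, hβ⟩ := h Nf hNf
  refine ⟨β₀, fun β hb => ?_⟩
  obtain ⟨μ, hμ, R, R', A, B, c, p, S₁, hc, hpow⟩ := hβ β hb
  exact ⟨μ, hμ, nonMassive_of_powerLaw_lower_bound Nf β μ R R' A B c p S₁ hc hpow⟩

/-! ## §6 Bookkeeping between revisions: T is the `ε = 1/2` instance of the rev-2 stub N -/

/-- **T from N.**  The rev-2 stub `stub_closingTransition` (N: for `N_f ∈ {2,3}` and every `ε > 0` there is `β₀`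
such that at every `β ≥ β₀` some `μ > −ε` is non-massive) implies the rev-3 stub T verbatim (`ε := 1/2`). [folklore] -/
theorem branchTransition_of_closingTransition :
    (∀ Nf : ℕ, Nf = 2 ∨ Nf = 3 → ∀ ε : ℝ, 0 < ε → ∃ β₀ : ℝ, ∀ β : ℝ, β₀ ≤ β → ∃ μ : ℝ, -ε < μ ∧
      ¬ (∀ (R R' : ℕ) (A : QCDLatticeObservable Nf R) (B : QCDLatticeObservable Nf R'),
        ∃ (C δ : ℝ) (S₀ : ℕ), 0 < δ ∧ ∀ S : ℕ, S₀ ≤ S → ∀ n : ℕ, n ≤ S →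
          ‖qcdLatticeConnectedCorr β (2 * S + 1) (fun _ : Fin Nf => μ) A B n‖ ≤ C * Real.exp (-(δ * n)))) →
    ∀ Nf : ℕ, Nf = 2 ∨ Nf = 3 → ∃ β₀ : ℝ, ∀ β : ℝ, β₀ ≤ β → ∃ μ : ℝ, -(1 / 2 : ℝ) < μ ∧
    ¬ (∀ (R R' : ℕ) (A : QCDLatticeObservable Nf R) (B : QCDLatticeObservable Nf R'),
    ∃ (C δ : ℝ) (S₀ : ℕ), 0 < δ ∧ ∀ S : ℕ, S₀ ≤ S → ∀ n : ℕ, n ≤ S →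
    ‖qcdLatticeConnectedCorr β (2 * S + 1) (fun _ : Fin Nf => μ) A B n‖ ≤ C * Real.exp (-(δ * n))) :=
  fun h Nf hNf => h Nf hNf (1 / 2) one_half_pos

end Summit.QuantumFields.QCD.Theorems.HonestHeavyAnchorBranchTransition
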